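import Summits.QuantumFields.YangMills.Theorems.LuscherReductionTwistedTraceScalingBOStiffQuasimodeAtomLow
import Summits.QuantumFields.YangMills.Theorems.LuscherReductionTwistedTraceScalingBOStiffQuasimodeFrame
import Summits.QuantumFields.YangMills.Theorems.FlatTubeReductionStiffKCentral
import HarnessLib


/-!
# (B-ST) K-port, part 7: the MODEL ATOM and `spec_S3` (the central quasimode of the fibre block), at a GENERAL CAP CONSTANT `K ≥ 1`
# (route `FlatTubeReduction`, crux K1 `NearFlatRatioLaw` stmt-QuantumFields-24720, line `ratepack_v2`, stub `stub_hST_A`; seat `ym-line-ftr-p1` g20; R2b1 RECORD rung — no summit statement is proved here)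

Lane A's ✓`…BOStiffQuasimodeAtomLow.quasimode_model_full_low/quasimode_model_low/spec_S3_low` and ✓`…BOStiffQuasimodeFrame.spec_S3_of_model` VERBATIM with the cap constant `43`
of `recordChi L s 43 M β` replaced by a parameter `K ≥ 1` (the rate twin's stub `stub_hST_A` needs `K = 42·max 1 (|Site 3 L|/7) + 1` at `s = 1/6`), in the K-vocabulary
`cWK`/`cΛK` of ✓`…FlatTubeReductionStiffKDefs`:
* ★★★ `quasimode_model_full_low_K`, ★★★ `quasimode_model_low_K` — the model atom (Q+), (Q−), ring, mass positivity at cap constant `K`;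
* ★★★ `spec_S3_of_model_K`, ★★★ `spec_S3_low_K` — (hup)+(hdef) of the hST assembly at cap constant `K`, UNCONDITIONAL.
HONEST FRAMING: text port (slot substitution `43 ↦ K`) of lane A's bookkeeping for a stub of the crux K1 of the CONDITIONAL route R2b1 (RECORD rung); no new mathematics; not infinite volume,
not a gap, not Clay.
-/

set_option autoImplicit false

noncomputable section

open MeasureTheory Filter Topology Real
open scoped BigOperators RealInnerProductSpace NNReal ENNReal
open Literature.MathematicalPhysics.QuantumFieldTheory
open Literature.MathematicalPhysics.QuantumLattice

namespace Summit.QuantumFields.YangMills.Theorems.FemtoTransferGap.TwoLattice.ConstTube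

open Summit.QuantumFields.YangMills.Theorems.FemtoTransferGap
open Summit.QuantumFields.YangMills.Theorems.FemtoTransferGap.TwoLattice
open Summit.QuantumFields.YangMills.Theorems.FemtoTransferGap.TwoLattice.Avg
open Summit.QuantumFields.YangMills.Theorems.FemtoTransferGap.TwoLattice.Stiff
open Summit.QuantumFields.YangMills.Theorems.FemtoTransferGap.TwoLattice.GnChart
open Summit.QuantumFields.YangMills.Theorems.FemtoTransferGap.TwoLattice.Cov
open Summit.QuantumFields.YangMills.Theorems.FemtoTransferGap.TwoLattice.Toron

variable {L : ℕ} [NeZero L]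

/-! ## §1 ★★★ The model atom at cap constant `K` -/

set_option maxHeartbeats 1600000 in
-- record-size data bookkeeping for `quasimode_of_twins`.
/-- ★★★ **THE (Q±) MODEL ATOM, full form, every exponent `0 < s ≤ 1/3`**: there is `M₀ ≥ 2` such that for all `M ≥ M₀`, `σ > 0`, eventually in `β`, with ONE level `λ > 0`:
(Q+) `∫cM(x,·)cΘdπ ≤ (1+σ)λ·cΘ(x)cWK(x)` on `cS`; (Q−) `(1−σ)λ·cΘ(x)cWK(x) ≤ ∫cM(x,·)cΘdπ` on `I = cS ∩ {‖x̂‖ ≤ r_f/12}`; the same two bounds for the MODEL JUMP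
`cK` at level `λ/cA` ((A5)); the ring clause `∫_{cS∖I}cΘ²cW ≤ σ∫cΘ²cW`; and `0 < ∫cΘ²cW`. [cite: Luscher1983, §3] -/
theorem quasimode_model_full_low_K {K : ℝ} (hK : 1 ≤ K) (hLz : Nonempty (NzSite L)) (hL2 : 2 ≤ L) {s : ℝ} (hs0 : 0 < s) (hs3 : s ≤ 1 / 3) :
    ∃ M₀ : ℝ, 2 ≤ M₀ ∧ ∀ M : ℝ, M₀ ≤ M → ∀ σ : ℝ, 0 < σ → ∀ᶠ β : ℝ in atTop, ∃ lam : ℝ, 0 < lam ∧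
      0 < ∫ x, cΘ L β x ^ 2 * cWK L s K M β x ∂orthoTransverse L ∧
      (∀ x ∈ cS L β, ∫ y, cM L β x y * cΘ L β y ∂orthoTransverse L ≤ (1 + σ) * lam * (cΘ L β x * cWK L s K M β x)) ∧
      (∀ x ∈ cS L β, ‖linkEmbed L x‖ ≤ min (1 / 40) (powScale (1 / 2) β * btLog β) / 12 →
        (1 - σ) * lam * (cΘ L β x * cWK L s K M β x) ≤ ∫ y, cM L β x y * cΘ L β y ∂orthoTransverse L) ∧
      (∀ x ∈ cS L β, ∫ y, cK L β x y * cΘ L β y ∂orthoTransverse L ≤ (1 + σ) * (lam / cA L β) * (cΘ L β x * cWK L s K M β x)) ∧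
      (∀ x ∈ cS L β, ‖linkEmbed L x‖ ≤ min (1 / 40) (powScale (1 / 2) β * btLog β) / 12 →
        (1 - σ) * (lam / cA L β) * (cΘ L β x * cWK L s K M β x) ≤ ∫ y, cK L β x y * cΘ L β y ∂orthoTransverse L) ∧
      ∫ x in cS L β \ (cS L β ∩ {x | ‖linkEmbed L x‖ ≤ min (1 / 40) (powScale (1 / 2) β * btLog β) / 12}), cΘ L β x ^ 2 * cWK L s K M β x ∂orthoTransverse L ≤
        σ * ∫ x, cΘ L β x ^ 2 * cWK L s K M β x ∂orthoTransverse L := by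
  haveI := isFiniteMeasure_orthoTransverse L
  have hs2 : s < 1 / 2 := by linarith
  obtain ⟨M₁, hM₁, HP⟩ := fpWeight_record_sandwich_K (L := L) hK hLz hs0 hs3
  obtain ⟨M₂, hM₂, HR⟩ := eventually_ring_mass_le_K (L := L) hK hLz hL2 hs0 hs3
  refine ⟨max M₁ M₂, hM₁.trans (le_max_left _ _), fun M hM σ hσ => ?_⟩
  obtain ⟨C, β₀, hC, hP⟩ := HP M (le_of_max_le_left hM)
  have hM2 : 2 ≤ M := hM₁.trans (le_of_max_le_left hM)
  -- the small parameter `a = σ'/8`, `σ' = min σ 1`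
  set σ' : ℝ := min σ 1 with hσ'
  have hσ'0 : 0 < σ' := lt_min hσ one_pos
  have hσ'1 : σ' ≤ 1 := min_le_right _ _
  have hσ'σ : σ' ≤ σ := min_le_left _ _
  set a : ℝ := σ' / 8 with ha
  have ha0 : 0 < a := by positivity
  have ha8 : a ≤ 1 / 8 := by rw [ha]; linarith
  have ha1 : a ≤ 1 := by linarith
  have h1a : 0 < 1 - a := by linarith
  have hδ2 : Tendsto (fun β => (K * powScale s β) ^ 2) atTop (𝓝 0) := by
    have hδ : Tendsto (fun β => K * powScale s β) atTop (𝓝 0) := by simpa using (tendsto_powScale hs0).const_mul K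
    simpa using hδ.pow 2
  filter_upwards [eventually_cM_flat_twins (L := L) hLz ha0, eventually_slice_two_sided (L := L) ha0,
    eventually_orthoTube_one_mem_fatTube_of_norm_le_K (L := L) hK hs0 hs2 hM2, eventually_ge_atTop β₀, eventually_mul_le_of_tendsto hδ2 C ha0,
    HR M (le_of_max_le_right hM) σ hσ, eventually_ge_atTop (1 : ℝ)] with β htw hsl hfat hββ₀ hκa hring hβ1
  obtain ⟨Λ, hΛ, hJup, hJlo⟩ := hsl
  have hβ0 : 0 ≤ β := by linarith
  -- data
  obtain ⟨hMm, -, -, -, hΘm, hΘ1, hΘ0, hΘS, hSm⟩ := central_kform_data (L := L) hβ0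
  obtain ⟨CM, hCM⟩ := cM_bounds (L := L) β
  obtain ⟨hWm, hWb, hW0⟩ := cWK_props (L := L) s K M β
  have hcA : 0 < cA L β := by unfold cA; exact mul_pos (by positivity) (fpWeightBar_pos L (powScale_pos _ _))
  have hcA' : cA L β ≠ 0 := hcA.ne'
  have hN0 : 0 < fpWeightBar L (powScale 1 β) := fpWeightBar_pos L (powScale_pos _ _)
  have hN0' : fpWeightBar L (powScale 1 β) ≠ 0 := hN0.ne'
  set κ : ℝ := C * (K * powScale s β) ^ 2 with hκdef
  have hκ0 : 0 ≤ κ := by positivity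
  have hκ1 : κ < 1 := by linarith
  have h1κ : 0 < 1 - κ := by linarith
  have hr0 : 0 ≤ min (1 / 40) (powScale (1 / 2) β * btLog β) := le_min (by norm_num) (mul_nonneg (powScale_pos _ _).le (zero_le_one.trans (one_le_btLog β)))
  -- weights on `cS`
  have hfatS : ∀ x ∈ cS L β, orthoTube L 1 x ∈ fatTubeRho L (fun β => K * powScale s β) (fun b => M * (K * powScale s b)) β :=
    fun x hx => hfat x (mem_cS hx).2
  have hΘw : ∀ x ∈ cS L β, cΘ L β x * cWK L s K M β x = Real.exp (-(stiffGaussExp L (β / 2) β (linkEmbed L x))) * gaugeAvg (recordChi L s K M β) (orthoTube L 1 x) :=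
    fun x hx => cΘ_mul_cWK_eq (L := L) s K M β hx (hfatS x hx)
  have hNlo : ∀ x ∈ cS L β, fpWeightBar L (powScale 1 β) * (1 - κ) ≤ gaugeAvg (recordChi L s K M β) (orthoTube L 1 x) := fun x hx => (hP β hββ₀ _ (hfatS x hx)).1
  have hNup : ∀ x ∈ cS L β, gaugeAvg (recordChi L s K M β) (orthoTube L 1 x) ≤ fpWeightBar L (powScale 1 β) * (1 + κ) := fun x hx => (hP β hββ₀ _ (hfatS x hx)).2
  -- hypotheses of `quasimode_of_twins`
  have hK : Measurable (Function.uncurry fun x y => cA L β * cK L β x y) := (measurable_cK (L := L) β).const_mul _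
  have hKb : ∀ x y, |cA L β * cK L β x y| ≤ cA L β := fun x y => by
    obtain ⟨h0, h1⟩ := cK_pos_le_one (L := L) hβ0 x y
    rw [abs_of_pos (mul_pos hcA h0)]; exact mul_le_of_le_one_right hcA.le h1
  have hMint : ∀ x ∈ cS L β, Integrable (fun y => cM L β x y * cΘ L β y) (orthoTransverse L) := fun x _ =>
    integrable_of_measurable_abs_le (orthoTransverse L) ((hMm.comp measurable_prodMk_left).mul hΘm) (C := CM * 1) fun y => by
      rw [abs_mul]; exact mul_le_mul (hCM x y).2.2 (hΘ1 y) (abs_nonneg _) ((abs_nonneg _).trans (hCM x y).2.2)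
  have hlo : ∀ x ∈ cS L β, ∀ y ∈ cS L β, (1 - a) * (cA L β * cK L β x y) ≤ cM L β x y := fun x hx y hy => (htw x hx y hy).1
  have hup : ∀ x ∈ cS L β, ∀ y ∈ cS L β, cM L β x y ≤ (1 + a) * (cA L β * cK L β x y) + 0 := fun x hx y hy => by rw [add_zero]; exact (htw x hx y hy).2
  have hintK : ∀ x, ∫ y, cA L β * cK L β x y * cΘ L β y ∂orthoTransverse L = cA L β * ∫ y, cK L β x y * cΘ L β y ∂orthoTransverse L := fun x => by
    rw [← integral_const_mul]; exact integral_congr_ae (ae_of_all _ fun y => mul_assoc _ _ _)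
  have hJup' : ∀ x ∈ cS L β, ∫ y, cA L β * cK L β x y * cΘ L β y ∂orthoTransverse L ≤ (1 + a) * (cA L β * Λ) * Real.exp (-(stiffGaussExp L (β / 2) β (linkEmbed L x))) := by
    intro x hx; rw [hintK]
    calc cA L β * ∫ y, cK L β x y * cΘ L β y ∂orthoTransverse L ≤ cA L β * ((1 + a) * Λ * Real.exp (-(stiffGaussExp L (β / 2) β (linkEmbed L x)))) :=
          mul_le_mul_of_nonneg_left (hJup x hx) hcA.le
      _ = _ := by ring
  have hJlo' : ∀ x ∈ cS L β ∩ {x | ‖linkEmbed L x‖ ≤ min (1 / 40) (powScale (1 / 2) β * btLog β) / 12},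
      (1 - a) * (cA L β * Λ) * Real.exp (-(stiffGaussExp L (β / 2) β (linkEmbed L x))) ≤ ∫ y, cA L β * cK L β x y * cΘ L β y ∂orthoTransverse L := by
    rintro x ⟨hx, hxI⟩; rw [hintK]
    calc (1 - a) * (cA L β * Λ) * Real.exp (-(stiffGaussExp L (β / 2) β (linkEmbed L x)))
        = cA L β * ((1 - a) * Λ * Real.exp (-(stiffGaussExp L (β / 2) β (linkEmbed L x)))) := by ring
      _ ≤ _ := mul_le_mul_of_nonneg_left (hJlo x hx hxI) hcA.le
  have htail : ∀ x ∈ cS L β, (0 : ℝ) * ∫ y, cΘ L β y ∂orthoTransverse L ≤ 0 * (cA L β * Λ) * Real.exp (-(stiffGaussExp L (β / 2) β (linkEmbed L x))) :=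
    fun x _ => by simp
  obtain ⟨hQp, hQm⟩ := quasimode_of_twins (μ := orthoTransverse L) (M := cM L β) (K := fun x y => cA L β * cK L β x y) (Θ := cΘ L β) (w := cWK L s K M β)
    (g := fun x => Real.exp (-(stiffGaussExp L (β / 2) β (linkEmbed L x)))) (N := fun x => gaugeAvg (recordChi L s K M β) (orthoTube L 1 x))
    (S := cS L β) (I := cS L β ∩ {x | ‖linkEmbed L x‖ ≤ min (1 / 40) (powScale (1 / 2) β * btLog β) / 12})
    hK hKb hΘm hΘ1 hΘ0 hΘS Set.inter_subset_left hMint ha0.le ha1 ha0.le ha1 le_rfl hκ0 hκ1 (mul_pos hcA hΛ).le hN0 (fun x => Real.exp_pos _)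
    hlo hup hJup' hJlo' hΘw hNlo hNup htail
  -- the level
  have hlam0 : 0 < cA L β * Λ / fpWeightBar L (powScale 1 β) := by positivity
  have hlamA : cA L β * Λ / fpWeightBar L (powScale 1 β) / cA L β = Λ / fpWeightBar L (powScale 1 β) := by
    rw [mul_div_assoc, mul_div_cancel_left₀ _ hcA']
  -- constants
  have hP1 : ((1 + a) * (1 + a) + 0) / (1 - κ) ≤ 1 + σ := by
    have h1 : ((1 + a) * (1 + a) + 0) / (1 - κ) ≤ ((1 + a) * (1 + a)) / (1 - a) := by
      rw [add_zero]; exact div_le_div_of_nonneg_left (by positivity) h1a (by linarith)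
    have h2 : (1 + a) * (1 + a) / (1 - a) ≤ 1 + σ' := by
      rw [div_le_iff₀ h1a, ha]; nlinarith [mul_nonneg hσ'0.le (sub_nonneg.2 hσ'1)]
    linarith
  have hP2 : 1 - σ ≤ (1 - a) * (1 - a) / (1 + κ) := by
    have h1 : (1 - a) * (1 - a) / (1 + a) ≤ (1 - a) * (1 - a) / (1 + κ) :=
      div_le_div_of_nonneg_left (by positivity) (by linarith) (by linarith)
    have h2 : 1 - σ' ≤ (1 - a) * (1 - a) / (1 + a) := by rw [le_div_iff₀ (by linarith), ha]; nlinarith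
    linarith
  have hΘW0 : ∀ x, 0 ≤ cΘ L β x * cWK L s K M β x := fun x => mul_nonneg (hΘ0 x) (hW0 x)
  -- (Q±) for `cM`
  have hQp' : ∀ x ∈ cS L β, ∫ y, cM L β x y * cΘ L β y ∂orthoTransverse L ≤ (1 + σ) * (cA L β * Λ / fpWeightBar L (powScale 1 β)) * (cΘ L β x * cWK L s K M β x) :=
    fun x hx => (hQp x hx).trans (mul_le_mul_of_nonneg_right (mul_le_mul_of_nonneg_right hP1 hlam0.le) (hΘW0 x))
  have hQm' : ∀ x ∈ cS L β, ‖linkEmbed L x‖ ≤ min (1 / 40) (powScale (1 / 2) β * btLog β) / 12 →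
      (1 - σ) * (cA L β * Λ / fpWeightBar L (powScale 1 β)) * (cΘ L β x * cWK L s K M β x) ≤ ∫ y, cM L β x y * cΘ L β y ∂orthoTransverse L :=
    fun x hx hxI => le_trans (mul_le_mul_of_nonneg_right (mul_le_mul_of_nonneg_right hP2 hlam0.le) (hΘW0 x)) (hQm x ⟨hx, hxI⟩)
  -- (Q±) for `cK` at level `λ/cA = Λ/N̄`
  have hg : ∀ x ∈ cS L β, Real.exp (-(stiffGaussExp L (β / 2) β (linkEmbed L x))) * (fpWeightBar L (powScale 1 β) * (1 - κ)) ≤ cΘ L β x * cWK L s K M β x ∧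
      cΘ L β x * cWK L s K M β x ≤ Real.exp (-(stiffGaussExp L (β / 2) β (linkEmbed L x))) * (fpWeightBar L (powScale 1 β) * (1 + κ)) := fun x hx => by
    rw [hΘw x hx]
    exact ⟨mul_le_mul_of_nonneg_left (hNlo x hx) (Real.exp_pos _).le, mul_le_mul_of_nonneg_left (hNup x hx) (Real.exp_pos _).le⟩
  have hKp : ∀ x ∈ cS L β, ∫ y, cK L β x y * cΘ L β y ∂orthoTransverse L ≤
      (1 + σ) * (cA L β * Λ / fpWeightBar L (powScale 1 β) / cA L β) * (cΘ L β x * cWK L s K M β x) := by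
    intro x hx
    have hc : 1 + a ≤ (1 + σ) * (1 - κ) := by
      have h1 : (1 + σ') * (1 - a) ≤ (1 + σ) * (1 - κ) := mul_le_mul (by linarith) (by linarith) h1a.le (by linarith)
      rw [ha] at h1 ⊢; nlinarith [mul_nonneg hσ'0.le (sub_nonneg.2 hσ'1)]
    rw [hlamA]
    calc ∫ y, cK L β x y * cΘ L β y ∂orthoTransverse L ≤ (1 + a) * Λ * Real.exp (-(stiffGaussExp L (β / 2) β (linkEmbed L x))) := hJup x hx
      _ ≤ (1 + σ) * (1 - κ) * Λ * Real.exp (-(stiffGaussExp L (β / 2) β (linkEmbed L x))) := by gcongr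
      _ = (1 + σ) * (Λ / fpWeightBar L (powScale 1 β)) * (Real.exp (-(stiffGaussExp L (β / 2) β (linkEmbed L x))) * (fpWeightBar L (powScale 1 β) * (1 - κ))) := by
          field_simp
      _ ≤ (1 + σ) * (Λ / fpWeightBar L (powScale 1 β)) * (cΘ L β x * cWK L s K M β x) := mul_le_mul_of_nonneg_left (hg x hx).1 (by positivity)
  have hKm : ∀ x ∈ cS L β, ‖linkEmbed L x‖ ≤ min (1 / 40) (powScale (1 / 2) β * btLog β) / 12 →
      (1 - σ) * (cA L β * Λ / fpWeightBar L (powScale 1 β) / cA L β) * (cΘ L β x * cWK L s K M β x) ≤ ∫ y, cK L β x y * cΘ L β y ∂orthoTransverse L := by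
    intro x hx hxI
    have hc : (1 - σ') * (1 + κ) ≤ 1 - a := by
      have h1 : (1 - σ') * (1 + κ) ≤ (1 - σ') * (1 + a) := mul_le_mul_of_nonneg_left (by linarith) (by linarith)
      rw [ha] at h1 ⊢; nlinarith
    rw [hlamA]
    have h1σ : 1 - σ ≤ 1 - σ' := by linarith
    have hpos : 0 ≤ Λ / fpWeightBar L (powScale 1 β) * (cΘ L β x * cWK L s K M β x) := mul_nonneg (by positivity) (hΘW0 x)
    calc (1 - σ) * (Λ / fpWeightBar L (powScale 1 β)) * (cΘ L β x * cWK L s K M β x)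
        = (1 - σ) * (Λ / fpWeightBar L (powScale 1 β) * (cΘ L β x * cWK L s K M β x)) := by ring
      _ ≤ (1 - σ') * (Λ / fpWeightBar L (powScale 1 β) * (cΘ L β x * cWK L s K M β x)) := mul_le_mul_of_nonneg_right h1σ hpos
      _ ≤ (1 - σ') * (Λ / fpWeightBar L (powScale 1 β) * (Real.exp (-(stiffGaussExp L (β / 2) β (linkEmbed L x))) * (fpWeightBar L (powScale 1 β) * (1 + κ)))) :=
          mul_le_mul_of_nonneg_left (mul_le_mul_of_nonneg_left (hg x hx).2 (by positivity)) (by linarith)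
      _ = (1 - σ') * (1 + κ) * Λ * Real.exp (-(stiffGaussExp L (β / 2) β (linkEmbed L x))) := by field_simp
      _ ≤ (1 - a) * Λ * Real.exp (-(stiffGaussExp L (β / 2) β (linkEmbed L x))) :=
          mul_le_mul_of_nonneg_right (mul_le_mul_of_nonneg_right hc hΛ.le) (Real.exp_pos _).le
      _ ≤ _ := hJlo x hx hxI
  -- positivity of the profile mass: `0 ∈ I`, `∫cK(0,·)cΘ > 0`, `cΘ²cW ≥ c_β·cΘ`
  have hZ : 0 < ∫ x, cΘ L β x ^ 2 * cWK L s K M β x ∂orthoTransverse L := by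
    have h0bal : (0 : Edge 3 L → Fin 3 → ℝ) ∈ balancedSet L := by simpa using flatMap_mem_balancedSet (L := L) β 0
    have h0S : (0 : Edge 3 L → Fin 3 → ℝ) ∈ cS L β := by
      rw [mem_cS_iff]
      exact ⟨mem_capBalancedSet_of_norm_le h0bal (by rw [map_zero, norm_zero]; norm_num), by rw [map_zero, norm_zero]; exact hr0⟩
    have h0I : ‖linkEmbed L (0 : Edge 3 L → Fin 3 → ℝ)‖ ≤ min (1 / 40) (powScale (1 / 2) β * btLog β) / 12 := by
      rw [map_zero, norm_zero]; positivity
    have hJ0 : 0 < ∫ y, cK L β 0 y * cΘ L β y ∂orthoTransverse L :=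
      lt_of_lt_of_le (mul_pos (mul_pos h1a hΛ) (Real.exp_pos _)) (hJlo 0 h0S h0I)
    have hΘi : Integrable (cΘ L β) (orthoTransverse L) := integrable_of_measurable_abs_le (orthoTransverse L) hΘm hΘ1
    have hKΘi : Integrable (fun y => cK L β 0 y * cΘ L β y) (orthoTransverse L) :=
      integrable_of_measurable_abs_le (orthoTransverse L) (((measurable_cK (L := L) β).comp measurable_prodMk_left).mul hΘm) (C := 1 * 1) fun y => by
        rw [abs_mul, abs_of_pos (cK_pos_le_one (L := L) hβ0 0 y).1]
        exact mul_le_mul (cK_pos_le_one (L := L) hβ0 0 y).2 (hΘ1 y) (abs_nonneg _) zero_le_one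
    have hJΘ : ∫ y, cK L β 0 y * cΘ L β y ∂orthoTransverse L ≤ ∫ y, cΘ L β y ∂orthoTransverse L :=
      integral_mono hKΘi hΘi fun y => mul_le_of_le_one_left (hΘ0 y) (cK_pos_le_one (L := L) hβ0 0 y).2
    set cβ : ℝ := Real.exp (-(49 * β * (min (1 / 40) (powScale (1 / 2) β * btLog β)) ^ 2)) * (fpWeightBar L (powScale 1 β) * (1 - κ)) with hcβ
    have hcβ0 : 0 < cβ := mul_pos (Real.exp_pos _) (mul_pos hN0 h1κ)
    have hpt : ∀ x, cβ * cΘ L β x ≤ cΘ L β x ^ 2 * cWK L s K M β x := by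
      intro x
      by_cases hx : x ∈ cS L β
      · have hq : stiffGaussExp L (β / 2) β (linkEmbed L x) ≤ 49 * β * (min (1 / 40) (powScale (1 / 2) β * btLog β)) ^ 2 := by
          have h1 := stiffGaussExp_le_mul_norm_sq (L := L) (t := β / 2) (by positivity) (b := β) hβ0 (linkEmbed L x)
          have h2 : ‖linkEmbed L x‖ ^ 2 ≤ (min (1 / 40) (powScale (1 / 2) β * btLog β)) ^ 2 := pow_le_pow_left₀ (norm_nonneg _) (mem_cS hx).2 2
          nlinarith
        have hg1 : Real.exp (-(49 * β * (min (1 / 40) (powScale (1 / 2) β * btLog β)) ^ 2)) ≤ Real.exp (-(stiffGaussExp L (β / 2) β (linkEmbed L x))) :=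
          Real.exp_le_exp.2 (by linarith)
        calc cβ * cΘ L β x ≤ (Real.exp (-(stiffGaussExp L (β / 2) β (linkEmbed L x))) * (fpWeightBar L (powScale 1 β) * (1 - κ))) * cΘ L β x :=
              mul_le_mul_of_nonneg_right (mul_le_mul_of_nonneg_right hg1 (mul_pos hN0 h1κ).le) (hΘ0 x)
          _ ≤ (cΘ L β x * cWK L s K M β x) * cΘ L β x := mul_le_mul_of_nonneg_right (hg x hx).1 (hΘ0 x)
          _ = cΘ L β x ^ 2 * cWK L s K M β x := by ring
      · rw [hΘS x hx]; simp
    have hZi : Integrable (fun x => cΘ L β x ^ 2 * cWK L s K M β x) (orthoTransverse L) :=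
      integrable_of_measurable_abs_le (orthoTransverse L) ((hΘm.pow_const 2).mul hWm) (C := 1 * Real.exp ((Fintype.card (Edge 3 L) : ℝ) / powScale 1 β ^ 2)) fun x => by
        rw [abs_mul, abs_pow]; exact mul_le_mul (by nlinarith [hΘ1 x, abs_nonneg (cΘ L β x)]) (hWb x) (abs_nonneg _) zero_le_one
    calc (0 : ℝ) < cβ * ∫ y, cK L β 0 y * cΘ L β y ∂orthoTransverse L := mul_pos hcβ0 hJ0
      _ ≤ cβ * ∫ y, cΘ L β y ∂orthoTransverse L := mul_le_mul_of_nonneg_left hJΘ hcβ0.le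
      _ = ∫ y, cβ * cΘ L β y ∂orthoTransverse L := (integral_const_mul _ _).symm
      _ ≤ ∫ x, cΘ L β x ^ 2 * cWK L s K M β x ∂orthoTransverse L := integral_mono (hΘi.const_mul _) hZi hpt
  exact ⟨cA L β * Λ / fpWeightBar L (powScale 1 β), hlam0, hZ, hQp', hQm', hKp, hKm, hring⟩

/-- ★★★ **THE MODEL ATOM `hmodel` OF ✓`spec_S3_of_model_K`, VERBATIM and UNCONDITIONAL** (`I := cS ∩ {‖x̂‖ ≤ r_f/12}`). [cite: Luscher1983, §3] -/
theorem quasimode_model_low_K {K : ℝ} (hK : 1 ≤ K) (hLz : Nonempty (NzSite L)) (hL2 : 2 ≤ L) {s : ℝ} (hs0 : 0 < s) (hs3 : s ≤ 1 / 3) :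
    ∃ M₀ : ℝ, 2 ≤ M₀ ∧ ∀ M : ℝ, M₀ ≤ M → ∀ σ : ℝ, 0 < σ → ∀ᶠ β : ℝ in atTop, ∃ (lam : ℝ) (I : Set (Edge 3 L → Fin 3 → ℝ)),
      0 < lam ∧ MeasurableSet I ∧ I ⊆ cS L β ∧ 0 < ∫ x, cΘ L β x ^ 2 * cWK L s K M β x ∂orthoTransverse L ∧
      (∀ x ∈ cS L β, ∫ y, cM L β x y * cΘ L β y ∂orthoTransverse L ≤ (1 + σ) * lam * (cΘ L β x * cWK L s K M β x)) ∧
      (∀ x ∈ I, (1 - σ) * lam * (cΘ L β x * cWK L s K M β x) ≤ ∫ y, cM L β x y * cΘ L β y ∂orthoTransverse L) ∧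
      ∫ x in cS L β \ I, cΘ L β x ^ 2 * cWK L s K M β x ∂orthoTransverse L ≤ σ * ∫ x, cΘ L β x ^ 2 * cWK L s K M β x ∂orthoTransverse L := by
  obtain ⟨M₀, hM₀, H⟩ := quasimode_model_full_low_K (L := L) hK hLz hL2 hs0 hs3
  refine ⟨M₀, hM₀, fun M hM σ hσ => ?_⟩
  filter_upwards [H M hM σ hσ] with β hβ
  obtain ⟨lam, hlam, hZ, hQp, hQm, -, -, hring⟩ := hβ
  exact ⟨lam, cS L β ∩ {x | ‖linkEmbed L x‖ ≤ min (1 / 40) (powScale (1 / 2) β * btLog β) / 12}, hlam,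
    (measurableSet_cS β).inter (measurableSet_le (measurable_linkEmbed L).norm measurable_const), Set.inter_subset_left, hZ, hQp,
    fun x hx => hQm x hx.1 hx.2, hring⟩

set_option maxHeartbeats 1600000 in
-- record-size statement.
/-- ★★★ **SPEC (A) FROM THE MODEL ATOM.**  If, for all large `M` and every `σ > 0`, eventually in `β` there are a level `λ > 0` and a measurable inner set `I ⊆ cS β` with
(Q+) `∫ cM(x,·)cΘ ≤ (1+σ)λ·cΘ(x)cWK(x)` on `cS β`, (Q−) `(1−σ)λ·cΘ(x)cWK(x) ≤ ∫ cM(x,·)cΘ` on `I`, (ring) `∫_{cS∖I} cΘ²cW ≤ σ∫cΘ²cW`, and `0 < ∫cΘ²cW`,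
then the conclusion of `spec_S3` holds. [cite: Luscher1983, §3] -/
theorem spec_S3_of_model_K {s K : ℝ}
    (hmodel : ∃ M₀ : ℝ, 2 ≤ M₀ ∧ ∀ M : ℝ, M₀ ≤ M → ∀ σ : ℝ, 0 < σ → ∀ᶠ β : ℝ in atTop, ∃ (lam : ℝ) (I : Set (Edge 3 L → Fin 3 → ℝ)),
      0 < lam ∧ MeasurableSet I ∧ I ⊆ cS L β ∧ 0 < ∫ x, cΘ L β x ^ 2 * cWK L s K M β x ∂orthoTransverse L ∧
      (∀ x ∈ cS L β, ∫ y, cM L β x y * cΘ L β y ∂orthoTransverse L ≤ (1 + σ) * lam * (cΘ L β x * cWK L s K M β x)) ∧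
      (∀ x ∈ I, (1 - σ) * lam * (cΘ L β x * cWK L s K M β x) ≤ ∫ y, cM L β x y * cΘ L β y ∂orthoTransverse L) ∧
      ∫ x in cS L β \ I, cΘ L β x ^ 2 * cWK L s K M β x ∂orthoTransverse L ≤ σ * ∫ x, cΘ L β x ^ 2 * cWK L s K M β x ∂orthoTransverse L) :
    ∃ M₀ : ℝ, 2 ≤ M₀ ∧ ∀ M : ℝ, M₀ ≤ M → ∀ η : ℝ, 0 < η → ∀ η₂ : ℝ, 0 < η₂ → ∀ᶠ β : ℝ in atTop,
      (∀ x ∈ cS L β, ∫ y, cM L β x y * cΘ L β y ∂orthoTransverse L ≤ (1 + η) * cΛK L s K M β * (cΘ L β x * cWK L s K M β x)) ∧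
      (∫ x in cS L β, ((∫ y, cM L β x y * cΘ L β y ∂orthoTransverse L) - cΛK L s K M β * (cΘ L β x * cWK L s K M β x)) ^ 2 / cWK L s K M β x ∂orthoTransverse L ≤
        (η₂ * cΛK L s K M β) ^ 2 * ∫ x, cΘ L β x ^ 2 * cWK L s K M β x ∂orthoTransverse L) := by
  haveI := isFiniteMeasure_orthoTransverse L
  obtain ⟨M₀, hM₀, H⟩ := hmodel
  refine ⟨M₀, hM₀, fun M hM η hη η₂ hη₂ => ?_⟩
  set σ : ℝ := min (1 / 8) (min (η / 8) (η₂ ^ 2 / 10)) with hσdef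
  have hσ0 : 0 < σ := lt_min (by norm_num) (lt_min (by positivity) (by positivity))
  have hσ8 : σ ≤ 1 / 8 := min_le_left _ _
  have hση : σ ≤ η / 8 := (min_le_right _ _).trans (min_le_left _ _)
  have hση₂ : σ ≤ η₂ ^ 2 / 10 := (min_le_right _ _).trans (min_le_right _ _)
  obtain ⟨hr1, hr2⟩ := quasimode_rates hσ0 hσ8 hη hση hση₂
  filter_upwards [H M hM σ hσ0, eventually_ge_atTop (0 : ℝ)] with β hβ hβ0
  obtain ⟨lam, I, hlam, hI, hIS, hZ, hQp, hQm, hring⟩ := hβ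
  obtain ⟨hMm, -, -, -, hΘm, hΘ1, hΘ0, hΘS, hSm⟩ := central_kform_data (L := L) hβ0
  obtain ⟨CM, hCM⟩ := cM_bounds (L := L) β
  obtain ⟨hwm, hwb, hw0⟩ := cWK_props (L := L) s K M β
  obtain ⟨hup, hdef⟩ := hup_hdef_of_model (μ := orthoTransverse L) hMm (fun x y => (hCM x y).2.2) (fun x y => (hCM x y).1) hΘm hΘ1 hΘ0 hΘS hSm hI hIS hwm hwb hw0 hZ
    hlam hσ0.le (by linarith) hQp hQm hring
  have eΛ : cΛK L s K M β = (∫ x, cΘ L β x * ∫ y, cM L β x y * cΘ L β y ∂orthoTransverse L ∂orthoTransverse L) / ∫ x, cΘ L β x ^ 2 * cWK L s K M β x ∂orthoTransverse L := by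
    unfold cΛK; rw [cLambda_num_eq]
  have hΛ0 : 0 ≤ cΛK L s K M β := by
    rw [eΛ]; exact div_nonneg (integral_nonneg fun x => mul_nonneg (hΘ0 x) (integral_nonneg fun y => mul_nonneg (hCM x y).1 (hΘ0 y))) hZ.le
  rw [← eΛ] at hup hdef
  refine ⟨fun x hx => (hup x hx).trans ?_, hdef.trans ?_⟩
  · exact mul_le_mul_of_nonneg_right (mul_le_mul_of_nonneg_right hr1 hΛ0) (mul_nonneg (hΘ0 x) (hw0 x))
  · rw [mul_pow]
    exact mul_le_mul_of_nonneg_right (mul_le_mul_of_nonneg_right hr2 (sq_nonneg _)) (integral_nonneg fun x => mul_nonneg (sq_nonneg _) (hw0 x))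

/-- ★★★ **spec_S3, UNCONDITIONAL** (the `hS3` hypothesis of ✓`hcore_record_of_specs` / ✓`hST_record_of_specs` / ✓`recordAnalyticInput_of_specs`): for `0 < s ≤ 1/3` there is
`M₀ ≥ 2` such that for all `M ≥ M₀`, `η, η₂ > 0`, eventually in `β`: (hup) `∫cM(x,·)cΘdπ ≤ (1+η)cΛK·cΘ(x)cWK(x)` on `cS`, and (hdef) the quasimode defect is `≤ (η₂cΛ)²∫cΘ²cW`. [cite: Luscher1983, §3] -/
theorem spec_S3_low_K {K : ℝ} (hK : 1 ≤ K) (hLz : Nonempty (NzSite L)) (hL2 : 2 ≤ L) {s : ℝ} (hs0 : 0 < s) (hs3 : s ≤ 1 / 3) :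
    ∃ M₀ : ℝ, 2 ≤ M₀ ∧ ∀ M : ℝ, M₀ ≤ M → ∀ η : ℝ, 0 < η → ∀ η₂ : ℝ, 0 < η₂ → ∀ᶠ β : ℝ in atTop,
      (∀ x ∈ cS L β, ∫ y, cM L β x y * cΘ L β y ∂orthoTransverse L ≤ (1 + η) * cΛK L s K M β * (cΘ L β x * cWK L s K M β x)) ∧
      (∫ x in cS L β, ((∫ y, cM L β x y * cΘ L β y ∂orthoTransverse L) - cΛK L s K M β * (cΘ L β x * cWK L s K M β x)) ^ 2 / cWK L s K M β x ∂orthoTransverse L ≤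
        (η₂ * cΛK L s K M β) ^ 2 * ∫ x, cΘ L β x ^ 2 * cWK L s K M β x ∂orthoTransverse L) :=
  spec_S3_of_model_K (quasimode_model_low_K (L := L) hK hLz hL2 hs0 hs3)

end Summit.QuantumFields.YangMills.Theorems.FemtoTransferGap.TwoLattice.ConstTube

end
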